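import Mathlib
import Literature.Analysis.FluidPDE.VectorCalculus

/-!
# Route `FilamentSkeletonRss` · twin child cruxes `TangentSkeletonNearStraight` (stmt-28295) / `TangentSkeletonNearStraightL` (stmt-23320) ·
# shared registered stub `stub_stripPropagation : StripPropagation` — brick: PARAMETER REVERSAL OF ONE FILAMENT LEAVES THE BIOT–SAVART FIELD INVARIANT

The stub-level symmetry behind «WLOG the near end of the stadium is the RIGHT end»: reversing the parametrisation of filament `j` about a point `c`
(`X j ↦ X j ∘ (c − ·)`, hence `deriv ↦ −deriv ∘ (c − ·)`, core area `Aa j ↦ Aa j ∘ (c − ·)`) and flipping its circulation (`γ j ↦ −γ j`) leaves the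
matched Biot–Savart field of the stub UNCHANGED as a field on `ℝ³` (the two signs cancel, Lebesgue measure is reflection invariant), while the target
function `τ ↦ u X (X j τ)` becomes its reflection `τ ↦ u X (X j (c − τ))`.  With `c = 2c_j` this maps left-half targets of filament `j`'s output stadium
to right-half targets of the reversed datum (whose stadium data are supplied by `Theorems.StadiumCentreReflection`), and `Theorems.StadiumGlue` glues the
two halves — so a quarter-width core proved for right-half targets only yields the full core.
* §1 `deriv_comp_reversal` (unconditional, junk values included), `iteratedDeriv_two_comp_reversal`, `cross_neg_left`;
* §2 `biotSavart_summand_reversal` — the `j`-th summand with reversed curve equals MINUS the original with the core factor read at `c − s`;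
* §3 `biotSavart_field_reversal` — the stub's defining equation for `u` (hypothesis `hu`, verbatim) transfers to `ũ Z y := u (update Z j (Z j ∘ (c − ·))) y`
  with circulations `update γ j (−γ j)` and core areas `update Aa j (Aa j ∘ (c − ·))`; `biotSavart_target_reversal` — `ũ X̃ (X̃ j τ) = u X (X j (c − τ))`.
HONEST FRAMING: a bookkeeping brick for a HYPOTHETICAL filament skeleton on the NEGATIVE side of a MODEL route; no stub of 28295 / 23320 is closed here;
nothing here bears on Navier–Stokes regularity or blow-up.  `--supports stmt-NavierStokesRegularity-28295`.
-/

set_option linter.dupNamespace false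

noncomputable section

namespace Summit.NavierStokesRegularity.NavierStokesRegularity.Theorems.StadiumParameterReversal

open MeasureTheory Literature.Analysis.FluidPDE
open scoped Matrix

/-! ## §1  Calculus of the reversal `s ↦ c − s` -/

/-- **Derivative of a reversed curve, unconditionally**: `deriv (Z ∘ (c − ·)) σ = −Z′(c − σ)` (both sides are the junk value `0` when `Z` is not
differentiable at `c − σ`). [folklore] -/
theorem deriv_comp_reversal {E : Type*} [NormedAddCommGroup E] [NormedSpace ℝ E] (Z : ℝ → E) (c σ : ℝ) :
    deriv (fun s => Z (c - s)) σ = -deriv Z (c - σ) := by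
  by_cases h : DifferentiableAt ℝ Z (c - σ)
  · have hρ : HasDerivAt (fun s : ℝ => c - s) (-1) σ := by simpa using (hasDerivAt_id σ).const_sub c
    have h1 : HasDerivAt (fun s => Z (c - s)) ((-1 : ℝ) • deriv Z (c - σ)) σ := h.hasDerivAt.scomp σ hρ
    rw [h1.deriv, neg_one_smul]
  · have h2 : ¬DifferentiableAt ℝ (fun s => Z (c - s)) σ := by
      intro h2
      apply h
      have hρ' : DifferentiableAt ℝ (fun s : ℝ => c - s) (c - σ) := (differentiableAt_const _).sub differentiableAt_id
      have h3 : DifferentiableAt ℝ (fun s => Z (c - s)) (c - (c - σ)) := by rw [sub_sub_cancel]; exact h2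
      have := h3.comp (c - σ) hρ'
      simpa [Function.comp_def] using this
    rw [deriv_zero_of_not_differentiableAt h, deriv_zero_of_not_differentiableAt h2, neg_zero]

/-- As functions: `deriv (Z ∘ (c − ·)) = −(deriv Z) ∘ (c − ·)`. [folklore] -/
theorem deriv_comp_reversal_fun {E : Type*} [NormedAddCommGroup E] [NormedSpace ℝ E] (Z : ℝ → E) (c : ℝ) :
    deriv (fun s => Z (c - s)) = fun σ => -deriv Z (c - σ) :=
  funext fun σ => deriv_comp_reversal Z c σ

/-- **Second derivative of a reversed curve, unconditionally**: `iteratedDeriv 2 (Z ∘ (c − ·)) σ = iteratedDeriv 2 Z (c − σ)`. [folklore] -/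
theorem iteratedDeriv_two_comp_reversal {E : Type*} [NormedAddCommGroup E] [NormedSpace ℝ E] (Z : ℝ → E) (c σ : ℝ) :
    iteratedDeriv 2 (fun s => Z (c - s)) σ = iteratedDeriv 2 Z (c - σ) := by
  have h2 : ∀ f : ℝ → E, iteratedDeriv 2 f = deriv (deriv f) := fun f => by
    rw [show (2:ℕ) = 1 + 1 from rfl, iteratedDeriv_succ, iteratedDeriv_one]
  rw [h2, h2, deriv_comp_reversal_fun Z c]
  rw [show (fun σ => -deriv Z (c - σ)) = -(fun s => deriv Z (c - s)) from rfl, deriv.neg,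
    deriv_comp_reversal (deriv Z) c σ, neg_neg]

/-- The tree's cross product is odd in the first slot. [folklore] -/
theorem cross_neg_left (a b : EuclideanSpace ℝ (Fin 3)) : cross (-a) b = -cross a b := by
  have h : (WithLp.ofLp (-a)) ⨯₃ (WithLp.ofLp b) = -((WithLp.ofLp a) ⨯₃ (WithLp.ofLp b)) := by
    rw [WithLp.ofLp_neg, map_neg, LinearMap.neg_apply]
  simp only [cross, h, WithLp.toLp_neg]

/-! ## §2  One Biot–Savart summand under reversal -/

/-- **Reversed summand.**  For ANY curve `Z : ℝ → ℝ³`, core factor `a : ℝ → ℝ`, constant `κ` and point `y`: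
`∫σ ((‖y − Z(c−σ)‖² + κ·a σ)^{3/2})⁻¹ • (deriv (Z∘(c−·)) σ × (y − Z(c−σ))) dσ = −∫s ((‖y − Z s‖² + κ·a(c−s))^{3/2})⁻¹ • (Z′ s × (y − Z s)) ds`
(reflection invariance of Lebesgue measure; no integrability needed). [folklore] -/
theorem biotSavart_summand_reversal (Z : ℝ → EuclideanSpace ℝ (Fin 3)) (a : ℝ → ℝ) (κ c : ℝ) (y : EuclideanSpace ℝ (Fin 3)) :
    ∫ σ : ℝ, ((‖y - Z (c - σ)‖ ^ 2 + κ * a σ) ^ (3/2:ℝ))⁻¹ • cross (deriv (fun s => Z (c - s)) σ) (y - Z (c - σ)) =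
      -∫ s : ℝ, ((‖y - Z s‖ ^ 2 + κ * a (c - s)) ^ (3/2:ℝ))⁻¹ • cross (deriv Z s) (y - Z s) := by
  have hpt : ∀ σ : ℝ, ((‖y - Z (c - σ)‖ ^ 2 + κ * a σ) ^ (3/2:ℝ))⁻¹ • cross (deriv (fun s => Z (c - s)) σ) (y - Z (c - σ)) =
      -((fun s : ℝ => ((‖y - Z s‖ ^ 2 + κ * a (c - s)) ^ (3/2:ℝ))⁻¹ • cross (deriv Z s) (y - Z s)) (c - σ)) := by
    intro σ
    simp only [deriv_comp_reversal Z c σ, cross_neg_left, smul_neg, sub_sub_cancel]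
  simp_rw [hpt]
  rw [integral_neg, integral_sub_left_eq_self (fun s : ℝ => ((‖y - Z s‖ ^ 2 + κ * a (c - s)) ^ (3/2:ℝ))⁻¹ • cross (deriv Z s) (y - Z s))
    volume c]

/-- **With the flipped circulation the summand is invariant.** [folklore] -/
theorem biotSavart_summand_reversal_coeff (Z : ℝ → EuclideanSpace ℝ (Fin 3)) (a : ℝ → ℝ) (κ c Γ g : ℝ) (y : EuclideanSpace ℝ (Fin 3)) :
    (Γ * (-g) / (4 * Real.pi)) • ∫ σ : ℝ, ((‖y - Z (c - σ)‖ ^ 2 + κ * a σ) ^ (3/2:ℝ))⁻¹ • cross (deriv (fun s => Z (c - s)) σ) (y - Z (c - σ)) =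
      (Γ * g / (4 * Real.pi)) • ∫ s : ℝ, ((‖y - Z s‖ ^ 2 + κ * a (c - s)) ^ (3/2:ℝ))⁻¹ • cross (deriv Z s) (y - Z s) := by
  rw [biotSavart_summand_reversal, smul_neg, ← neg_smul]
  congr 1
  ring

/-! ## §3  The stub's defining equation for `u` under reversal of filament `j` -/

/-- **The Biot–Savart field of the stub is invariant under reversal of one filament with flipped circulation.**  If `u` satisfies the stub's
defining equation (hypothesis `hu`, verbatim) for circulations `γ` and core areas `Aa`, then `ũ Z y := u (update Z j (Z j ∘ (c − ·))) y` satisfies it for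
`update γ j (−γ j)` and `update Aa j (Aa j ∘ (c − ·))`. [folklore] -/
theorem biotSavart_field_reversal {N : ℕ} {Γ : ℝ} {γ : Fin N → ℝ} {Aa : Fin N → ℝ → ℝ}
    {u : (Fin N → ℝ → EuclideanSpace ℝ (Fin 3)) → EuclideanSpace ℝ (Fin 3) → EuclideanSpace ℝ (Fin 3)}
    (hu : ∀ Z y, u Z y = ∑ k, (Γ*γ k/(4*Real.pi))•∫ σ:ℝ, ((‖y-Z k σ‖^2+Real.exp (-(1+Real.eulerMascheroniConstant-Real.log 2))*Aa k σ)^(3/2:ℝ))⁻¹•cross (deriv (Z k) σ) (y-Z k σ))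
    (j : Fin N) (c : ℝ) :
    ∀ Z y, (fun Z y => u (Function.update Z j (fun s => Z j (c - s))) y) Z y =
      ∑ k, (Γ*(Function.update γ j (-γ j)) k/(4*Real.pi))•∫ σ:ℝ, ((‖y-Z k σ‖^2+Real.exp (-(1+Real.eulerMascheroniConstant-Real.log 2))*
        (Function.update Aa j (fun s => Aa j (c - s))) k σ)^(3/2:ℝ))⁻¹•cross (deriv (Z k) σ) (y-Z k σ) := by
  intro Z y
  simp only
  rw [hu]
  refine Finset.sum_congr rfl fun k _ => ?_
  by_cases hk : k = j
  · subst hk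
    simp only [Function.update_self]
    have h := biotSavart_summand_reversal_coeff (Z k) (Aa k) (Real.exp (-(1+Real.eulerMascheroniConstant-Real.log 2))) c Γ (-γ k) y
    rw [neg_neg] at h
    exact h
  · simp only [Function.update_of_ne hk]

/-- **The target function is reflected.**  With `X̃ := update X j (X j ∘ (c − ·))`: `ũ X̃ y = u X y` for every `y` (reversal is an involution), in
particular `ũ X̃ (X̃ j τ) = u X (X j (c − τ))`. [folklore] -/
theorem biotSavart_target_reversal {N : ℕ}
    (u : (Fin N → ℝ → EuclideanSpace ℝ (Fin 3)) → EuclideanSpace ℝ (Fin 3) → EuclideanSpace ℝ (Fin 3))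
    (X : Fin N → ℝ → EuclideanSpace ℝ (Fin 3)) (j : Fin N) (c : ℝ) :
    (∀ y, (fun Z y => u (Function.update Z j (fun s => Z j (c - s))) y) (Function.update X j (fun s => X j (c - s))) y = u X y) ∧
    (∀ τ, (fun Z y => u (Function.update Z j (fun s => Z j (c - s))) y) (Function.update X j (fun s => X j (c - s)))
        ((Function.update X j (fun s => X j (c - s))) j τ) = u X (X j (c - τ))) := by
  have hinv : Function.update (Function.update X j (fun s => X j (c - s))) j
      (fun s => (Function.update X j (fun s => X j (c - s))) j (c - s)) = X := by
    rw [Function.update_idem]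
    have : (fun s => (Function.update X j (fun s => X j (c - s))) j (c - s)) = X j := by
      funext s; simp [sub_sub_cancel]
    rw [this, Function.update_eq_self]
  refine ⟨fun y => ?_, fun τ => ?_⟩
  · show u _ y = u X y
    rw [hinv]
  · show u _ _ = u X (X j (c - τ))
    rw [hinv, Function.update_self]

/-! ## §4  The other per-filament hypotheses of the stub under reversal of filament `j` -/

/-- **Circulation bound** transported. [folklore] -/
theorem reversal_gamma_bound {N : ℕ} {γ : Fin N → ℝ} {θ₀ : ℝ} (hγ : ∀ k, |γ k| ≤ θ₀⁻¹) (j : Fin N) :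
    ∀ k, |(Function.update γ j (-γ j)) k| ≤ θ₀⁻¹ := by
  intro k
  by_cases hk : k = j
  · subst hk; simp only [Function.update_self, abs_neg]; exact hγ k
  · simp only [Function.update_of_ne hk]; exact hγ k

/-- **Curve regularity / unit speed / curvature / tangent oscillation** transported (the stub's third hypothesis group, verbatim shape). [folklore] -/
theorem reversal_curve_hyps {N : ℕ} {Γ K Rb : ℝ} {X : Fin N → ℝ → EuclideanSpace ℝ (Fin 3)}
    (hX : ∀ k, ContDiff ℝ 2 (X k) ∧ (∀ τ, ‖deriv (X k) τ‖ = 1) ∧ (∀ τ, ‖iteratedDeriv 2 (X k) τ‖ * √Γ ≤ K) ∧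
      ∀ τ σ, ‖deriv (X k) τ - deriv (X k) σ‖ ≤ Rb) (j : Fin N) (c : ℝ) :
    ∀ k, ContDiff ℝ 2 ((Function.update X j (fun s => X j (c - s))) k) ∧
      (∀ τ, ‖deriv ((Function.update X j (fun s => X j (c - s))) k) τ‖ = 1) ∧
      (∀ τ, ‖iteratedDeriv 2 ((Function.update X j (fun s => X j (c - s))) k) τ‖ * √Γ ≤ K) ∧
      ∀ τ σ, ‖deriv ((Function.update X j (fun s => X j (c - s))) k) τ - deriv ((Function.update X j (fun s => X j (c - s))) k) σ‖ ≤ Rb := by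
  intro k
  by_cases hk : k = j
  · subst hk
    simp only [Function.update_self]
    obtain ⟨h1, h2, h3, h4⟩ := hX k
    refine ⟨h1.comp (contDiff_const.sub contDiff_id), fun τ => ?_, fun τ => ?_, fun τ σ => ?_⟩
    · rw [deriv_comp_reversal, norm_neg]; exact h2 _
    · rw [iteratedDeriv_two_comp_reversal]; exact h3 _
    · rw [deriv_comp_reversal, deriv_comp_reversal, show -deriv (X k) (c - τ) - -deriv (X k) (c - σ) =
        -(deriv (X k) (c - τ) - deriv (X k) (c - σ)) by abel, norm_neg]
      exact h4 _ _
  · simp only [Function.update_of_ne hk]; exact hX k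

/-- **Separation** transported (point sets are unchanged). [folklore] -/
theorem reversal_separation {N : ℕ} {d : ℝ} {X : Fin N → ℝ → EuclideanSpace ℝ (Fin 3)}
    (hsep : ∀ k l, k ≠ l → ∀ τ σ, d ≤ ‖X k τ - X l σ‖) (j : Fin N) (c : ℝ) :
    ∀ k l, k ≠ l → ∀ τ σ, d ≤ ‖(Function.update X j (fun s => X j (c - s))) k τ - (Function.update X j (fun s => X j (c - s))) l σ‖ := by
  intro k l hkl τ σ
  by_cases hk : k = j
  · subst hk
    have hl : l ≠ k := fun h => hkl h.symm
    simp only [Function.update_self, Function.update_of_ne hl]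
    exact hsep k l hkl _ _
  · by_cases hl : l = j
    · subst hl
      simp only [Function.update_self, Function.update_of_ne hk]
      exact hsep k l hkl _ _
    · simp only [Function.update_of_ne hk, Function.update_of_ne hl]
      exact hsep k l hkl _ _

/-- **Chord–arc** transported (`|τ − σ| = |(c − τ) − (c − σ)|`). [folklore] -/
theorem reversal_chordArc {N : ℕ} {d e : ℝ} {X : Fin N → ℝ → EuclideanSpace ℝ (Fin 3)}
    (hca : ∀ k τ σ, d ≤ |τ - σ| → e ≤ ‖X k τ - X k σ‖) (j : Fin N) (c : ℝ) :
    ∀ k τ σ, d ≤ |τ - σ| → e ≤ ‖(Function.update X j (fun s => X j (c - s))) k τ - (Function.update X j (fun s => X j (c - s))) k σ‖ := by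
  intro k τ σ h
  by_cases hk : k = j
  · subst hk
    simp only [Function.update_self]
    refine hca k _ _ ?_
    rw [show c - τ - (c - σ) = -(τ - σ) by ring, abs_neg]; exact h
  · simp only [Function.update_of_ne hk]; exact hca k τ σ h

/-- **Core areas** transported (differentiability, floor, growth bound against the reversed curve). [folklore] -/
theorem reversal_area_hyps {N : ℕ} {Λ KA Γ : ℝ} {X : Fin N → ℝ → EuclideanSpace ℝ (Fin 3)} {Aa : Fin N → ℝ → ℝ}
    (hA : ∀ k, Differentiable ℝ (Aa k) ∧ (∀ τ, Λ⁻¹ ≤ Aa k τ) ∧ ∀ τ, Aa k τ ≤ KA * (1 + Γ + ‖X k τ‖ ^ 2)) (j : Fin N) (c : ℝ) :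
    ∀ k, Differentiable ℝ ((Function.update Aa j (fun s => Aa j (c - s))) k) ∧
      (∀ τ, Λ⁻¹ ≤ (Function.update Aa j (fun s => Aa j (c - s))) k τ) ∧
      ∀ τ, (Function.update Aa j (fun s => Aa j (c - s))) k τ ≤ KA * (1 + Γ + ‖(Function.update X j (fun s => X j (c - s))) k τ‖ ^ 2) := by
  intro k
  by_cases hk : k = j
  · subst hk
    simp only [Function.update_self]
    obtain ⟨h1, h2, h3⟩ := hA k
    exact ⟨h1.comp ((differentiable_const _).sub differentiable_id), fun τ => h2 _, fun τ => h3 _⟩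
  · simp only [Function.update_of_ne hk]; exact hA k

end Summit.NavierStokesRegularity.NavierStokesRegularity.Theorems.StadiumParameterReversal
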